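import Literature.Analysis.Fourier.TaylorRemainder
import Mathlib.Tactic
import HarnessLib

/-!
# The germ identity for the pullback coefficients (CDT eq. (6.16))

Calegari–Dimitrov–Tang, arXiv:2408.15403, §6.4 (p. 51): the damped pullback is built from the
one-variable holomorphic functions `u(z) = h(z) f(Φ(z))` (`h` clearing the poles of `f ∘ Φ`,
`h(0) = 1`, `Φ(0) = 0`), and its Taylor coefficients are computed by expanding `f` in powers of
`Φ(z)`: **`[z^r](Φ^k u) = Σ_{q ≤ r} b_q(f) · [z^r](Φ^{k+q} h)`**, `b_q(f)` the Taylor coefficients of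
`f` at `0`. Only the germ of `u` at `0` enters (the expansion of `f(Φ(z))` need not converge on the
whole disc), which is why the proof goes through the truncated Taylor remainder of `f`
(`exists_taylorRemainder`), a radius on which `Φ` maps into the disc of `f`
(`exists_radius_mapsTo`), germ determinacy (`taylorCoeff_congr_of_eventuallyEq`) and the transfer
property below the diagonal (`taylorCoeff_comp_pow_mul_of_lt`). Together with
`TransferCoefficients` this provides the `TransferData`/`pullCoeff` description of
`PullbackLowestCoefficient` for the actual analytic pullback.

No named facts.

## References

* [CalegariDimitrovTang2024] arXiv:2408.15403, §6.4 eq. (6.15)–(6.16) (p. 51).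
-/

noncomputable section

open Complex Metric Filter Set

open scoped Real NNReal Topology

namespace Literature.Analysis.Fourier

namespace TorusCoeff

/-- A radius on which `Φ` (continuous, `Φ(0) = 0`) maps into a prescribed disc. [folklore] -/
theorem exists_radius_mapsTo {Φ : ℂ → ℂ} {R : ℝ≥0} (hR : 0 < R) (hΦ : ContinuousOn Φ (closedBall 0 R))
    (hΦ0 : Φ 0 = 0) {ρ : ℝ} (hρ : 0 < ρ) :
    ∃ R' : ℝ≥0, 0 < R' ∧ R' ≤ R ∧ MapsTo Φ (closedBall (0 : ℂ) R') (closedBall 0 ρ) := by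
  have h0 : (0 : ℂ) ∈ closedBall (0 : ℂ) R := by simp
  have hc := Metric.continuousWithinAt_iff.mp (hΦ 0 h0) ρ hρ
  obtain ⟨δ, hδ, hδρ⟩ := hc
  have hRr : (0 : ℝ) < R := by exact_mod_cast hR
  refine ⟨⟨min (δ / 2) R, by positivity⟩, ?_, ?_, fun x hx => ?_⟩
  · show (0 : ℝ) < min (δ / 2) R
    exact lt_min (by positivity) hRr
  · show min (δ / 2) (R : ℝ) ≤ R
    exact min_le_right _ _
  · have hx' : ‖x‖ ≤ min (δ / 2) R := by
      rw [mem_closedBall, dist_zero_right] at hx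
      exact hx
    have hxR : x ∈ closedBall (0 : ℂ) R := by
      rw [mem_closedBall, dist_zero_right]; exact hx'.trans (min_le_right _ _)
    have hxδ : dist x 0 < δ := by
      rw [dist_zero_right]; exact lt_of_le_of_lt (hx'.trans (min_le_left _ _)) (by linarith)
    have := hδρ hxR hxδ
    rw [hΦ0, dist_zero_right] at this
    rw [mem_closedBall, dist_zero_right]
    exact this.le

/-- **The germ identity** (CDT eq. (6.16), one variable): for `u = h · (f ∘ Φ)` near `0`,
`[z^r](Φ^k u) = Σ_{q ≤ r} b_q(f) [z^r](Φ^{k+q} h)`.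
[cite: CalegariDimitrovTang2024, §6.4 eq. (6.15)–(6.16) (p. 51)] -/
theorem taylorCoeff_pow_mul_pullback {Φ h u f : ℂ → ℂ} {R ρ : ℝ≥0} (hR : 0 < R) (hρ : 0 < ρ)
    (hΦ : DifferentiableOn ℂ Φ (closedBall 0 R)) (hΦ0 : Φ 0 = 0)
    (hh : DifferentiableOn ℂ h (closedBall 0 R)) (hu : DifferentiableOn ℂ u (closedBall 0 R))
    (hf : DifferentiableOn ℂ f (closedBall 0 ρ)) (hgerm : u =ᶠ[𝓝 0] fun z => h z * f (Φ z))
    (k r : ℕ) :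
    taylorCoeff (fun z => Φ z ^ k * u z) R r =
      ∑ q ∈ Finset.range (r + 1), taylorCoeff f ρ q * taylorCoeff (fun z => Φ z ^ (k + q) * h z) R r := by
  obtain ⟨fr, hfr, hdec⟩ := exists_taylorRemainder hρ hf r
  obtain ⟨R', hR'0, hR'R, hmaps⟩ := exists_radius_mapsTo hR hΦ.continuousOn hΦ0 (by exact_mod_cast hρ : (0:ℝ) < ρ)
  have hsub : closedBall (0 : ℂ) R' ⊆ closedBall 0 R := closedBall_subset_closedBall (by exact_mod_cast hR'R)
  have hΦ' := hΦ.mono hsub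
  have hh' := hh.mono hsub
  have hu' := hu.mono hsub
  have hfrΦ : DifferentiableOn ℂ (fun z => fr (Φ z)) (closedBall 0 R') := hfr.comp hΦ' hmaps
  have hhfr : DifferentiableOn ℂ (fun z => h z * fr (Φ z)) (closedBall 0 R') := hh'.mul hfrΦ
  have hku : DifferentiableOn ℂ (fun z => Φ z ^ k * u z) (closedBall 0 R) := (hΦ.pow k).mul hu
  have hkq : ∀ q, DifferentiableOn ℂ (fun z => Φ z ^ (k + q) * h z) (closedBall 0 R) :=
    fun q => (hΦ.pow _).mul hh
  have hkq' : ∀ q, DifferentiableOn ℂ (fun z => Φ z ^ (k + q) * h z) (closedBall 0 R') :=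
    fun q => (hΦ'.pow _).mul hh'
  -- the truncated function `w`
  set b : ℕ → ℂ := fun q => taylorCoeff f ρ q with hb
  set w : ℂ → ℂ := fun z => (∑ q ∈ Finset.range (r + 1), b q * (Φ z ^ (k + q) * h z)) +
    Φ z ^ (k + r + 1) * (h z * fr (Φ z)) with hw
  have hw_hol : DifferentiableOn ℂ w (closedBall 0 R') := by
    refine DifferentiableOn.add ?_ ?_
    · exact DifferentiableOn.fun_sum fun q _ => (hkq' q).const_mul _
    · exact (hΦ'.pow _).mul hhfr
  -- `Φ^k u = w` near `0`
  have heq : (fun z => Φ z ^ k * u z) =ᶠ[𝓝 0] w := by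
    have hball : closedBall (0 : ℂ) R' ∈ 𝓝 (0 : ℂ) := closedBall_mem_nhds _ (by exact_mod_cast hR'0)
    filter_upwards [hgerm, hball] with z hz hzmem
    rw [hz, hdec (Φ z) (hmaps hzmem), hw]
    simp only
    rw [mul_add, mul_add, Finset.mul_sum, Finset.mul_sum]
    congr 1
    · refine Finset.sum_congr rfl fun q _ => ?_
      rw [pow_add]; ring
    · ring
  -- transfer to `w` on the small radius
  rw [taylorCoeff_congr_of_eventuallyEq hR hR'0 hku hw_hol heq r]
  -- linearity on the circle of radius `R'`
  have hR'r : (0 : ℝ) < R' := by exact_mod_cast hR'0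
  have hsph : sphere (0 : ℂ) R' ⊆ closedBall 0 R' := sphere_subset_closedBall
  have hc1 : ContinuousOn (fun z => ∑ q ∈ Finset.range (r + 1), b q * (Φ z ^ (k + q) * h z)) (sphere 0 R') :=
    continuousOn_finsetSum _ fun q _ =>
      continuousOn_const.mul ((hkq' q).continuousOn.mono hsph)
  have hlast : DifferentiableOn ℂ (fun z => Φ z ^ (k + r + 1) * (h z * fr (Φ z))) (closedBall 0 R') :=
    (hΦ'.pow _).mul hhfr
  have hc2 : ContinuousOn (fun z => Φ z ^ (k + r + 1) * (h z * fr (Φ z))) (sphere 0 R') :=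
    hlast.continuousOn.mono hsph
  rw [hw, taylorCoeff_add hR'r hc1 hc2,
    taylorCoeff_sum _ _ (fun q z => Φ z ^ (k + q) * h z) hR'r
      (fun q _ => (hkq' q).continuousOn.mono hsph),
    taylorCoeff_comp_pow_mul_of_lt hR'0 hΦ' hΦ0 hhfr (show r < k + r + 1 by omega), add_zero]
  refine Finset.sum_congr rfl fun q _ => ?_
  rw [taylorCoeff_eq_of_le hR'0 hR'R (hkq q)]

end TorusCoeff

end Literature.Analysis.Fourier
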